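import Summits.HubbardSuperconductivity.HubbardSuperconductivity.Theorems.AnisotropyChordTransferFibre3RowDCheckS
import Summits.HubbardSuperconductivity.HubbardSuperconductivity.Theorems.AnisotropyChordTransferFibre3RowDTOrbit
import Summits.HubbardSuperconductivity.HubbardSuperconductivity.Theorems.AnisotropyChordTransferFibre3ManifoldA64

/-!
# Route `AnisotropyChord` / H0 rotor rung, row D (KT-2a) on the t-BLOCKS: block twin of `…AnisotropyChordTransferFibre3RowDCheckS`

T-FORK (p2 g8; inventory memo HOME/hubbard-h0-rotor-p2/TBLOCK-INVENTORY-g8.md §3): the theorems of `…RowDCheckS` that carry the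
hypothesis `128 ≤ L` (or the `L2.NamedCell` cell box) restated in the namespace `RowD.T` with the SAME names for the t-blocks of
the range `48 ≤ L < 128` (route-lead ruling R1): analytic layer with `64 ≤ L` (family A at `L ≥ 64`: `ManifoldA.nu_ceiling64`,
`manifold_band64`), cell layer on block cells `c : L2.TCell` (`cellBoxB (c.box a₁ a₂)`, `pmem_xTrueT`,
`RowC.finalVec_mem_of_cellFinalBoxT`).  Definitions that do not depend on the cell are NOT duplicated (they resolve to `RowD`);
proofs are verbatim.  Kept: classCheckS, classCheckS_sound, lowG_of_orbitChecksS.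
Prover seat `hubbard-h0-rotor-p2` g8; helper for piece A = stmt-HubbardSuperconductivity-23918 of rung 19089 (`--supports`, helper
class).  Nothing here proves superconductivity in the Hubbard model; lemmas for ONE row of ONE conditional reduction on the t-blocks;
the rotor TARGET as originally worded stays FALSE (g15 verdict).  Tree imports only; no sorry.
-/

set_option linter.dupNamespace false
set_option autoImplicit false

open scoped BigOperators
open Literature.Analysis.ValidatedNumerics

namespace Summit.HubbardSuperconductivity.HubbardSuperconductivity.Theorems.AnisotropyChord.Transfer.Fibre3

namespace RowD

namespace T

open RowC L2 L2.N1

variable (L : ℕ) [NeZero L]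

/-! ## The first-order class check (computable) -/

/-- ★ FIRST-ORDER CHECK of ONE class against a rational budget `b`: the centred upper bound of the slope datum of
`termE τlo τhi k₂ k₃` on the row-D box (moving coordinates `ν`, `a` centred at the midpoints) is `≤ b`. -/
def classCheckS (c : L2.TCell) (a1 a2 τlo τhi : ℚ) (pi : ℕ × ℕ) (kk : (ℤ × ℤ) × (ℤ × ℤ)) (b : ℚ) : Bool :=
  match rowDBox c a1 a2 pi with
  | none => false
  | some B =>
    match sdEnclose pi.1 pi.2 (envC B) (termE τlo τhi kk.1 kk.2) with
    | none => false
    | some M => decide (M.ub (incrI (B.toIvl 2) (midI (B.toIvl 2))) (incrI (B.toIvl 3) (midI (B.toIvl 3))) ≤ b)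

omit [NeZero L] in
/-- ★ soundness of the first-order class check: `termE.eval x ≤ b` at every point of the row-D box. -/
theorem classCheckS_sound {c : L2.TCell} {a1 a2 τlo τhi : ℚ} {pi : ℕ × ℕ} {kk : (ℤ × ℤ) × (ℤ × ℤ)} {b : ℚ}
    (h : classCheckS c a1 a2 τlo τhi pi kk b = true) {B : Box} (hB : rowDBox c a1 a2 pi = some B)
    {x : ℕ → ℝ} (hx : B.mem x) :
    (termE τlo τhi kk.1 kk.2).eval x ≤ ((b : ℚ) : ℝ) := by
  unfold classCheckS at h
  rw [hB] at h
  simp only at h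
  split at h
  · exact absurd h (by simp)
  · rename_i M hM
    have hb : M.ub (incrI (B.toIvl 2) (midI (B.toIvl 2))) (incrI (B.toIvl 3) (midI (B.toIvl 3))) ≤ b := of_decide_eq_true h
    have hbd := sdEnclose_bounds (holds_envC hx) (incr_mem hx 2) (incr_mem hx 3) _ hM
    exact hbd.2.trans (by exact_mod_cast hb)

/-! ## The orbit form with first-order class checks -/

section sound
variable (Δ lam2 : ℝ) (f : Tor L → ℝ)

/-- ★★★ **ORBIT FORM of the row-D cell certificate with FIRST-ORDER class checks**: two representative tables, `repsZ = [(r_j, b_j)]`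
certified by p1's ZERO-ORDER `classCheck` and `repsS = [(r_j, b_j)]` certified by the FIRST-ORDER `classCheckS` (the orbit table indexes
`repsZ ++ repsS`; a generator puts each representative where its budget is smaller — the slope bound loses slightly on tiny classes through the
`|·|` remainder), each representative in `lowList`, an orbit table `orb = [(k, j, w)]` listing `lowList` with `w·k = r_j` (`orbitRowOk`), the budget
`Σ_k b_{j(k)} ≤ 3·(98696/10⁴)·a_D·ν₁·τlo`, the `ê₁` check and the `τ` check give `lowGForm ≤ a_D·η_eff·U` on the cell for every `L ≥ 128` —
the `hKT2a` hypothesis of `gm3_of_cell` (same conclusion as `lowG_of_orbitChecks`, which is the case `repsS = []`). -/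
theorem lowG_of_orbitChecksS (c : L2.TCell) (a1 a2 aD τlo τhi : ℚ) (pi piT : ℕ × ℕ)
    (repsZ repsS : List (((ℤ × ℤ) × (ℤ × ℤ)) × ℚ)) (orb : List (((ℤ × ℤ) × (ℤ × ℤ)) × (ℕ × List ℕ)))
    (hrepsMem : ((repsZ ++ repsS).all fun p => decide (p.1 ∈ lowList)) = true)
    (hrepsZ : (repsZ.all fun p => classCheck c a1 a2 τlo τhi pi p.1 p.2) = true)
    (hrepsS : (repsS.all fun p => classCheckS c a1 a2 τlo τhi pi p.1 p.2) = true)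
    (horb : orb.map Prod.fst = lowList) (hok : (orb.all (orbitRowOk (repsZ ++ repsS))) = true)
    (hsum : (orb.map (orbitBudget (repsZ ++ repsS))).sum ≤ 3 * (98696 / 10000) * aD * ((c.n1 : ℚ) / c.νd) * τlo)
    (haD : 0 ≤ aD) (hτlo0 : 0 ≤ τlo) (he1 : e1Check c a1 a2 τhi pi = true) (hτ : tauCheck c a1 a2 τlo τhi piT = true)
    (hc : c.check = true) (hL : 64 ≤ L) (hL0 : c.L0 ≤ L) (hL1 : c.L1 = 0 ∨ L ≤ c.L1)
    (hΔ0 : 0 ≤ Δ) (hΔ1 : Δ < 1) (hf : IsGroundTwoMagnon L Δ lam2 f)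
    (hν1 : (c.n1 : ℝ) / c.νd ≤ lam2 / (2 * Real.pi / L) ^ 2) (hν2 : lam2 / (2 * Real.pi / L) ^ 2 ≤ (c.n2 : ℝ) / c.νd)
    (ha1 : ((a1 : ℚ) : ℝ) ≤ Δ * f (K1 L)) (ha2 : Δ * f (K1 L) ≤ ((a2 : ℚ) : ℝ)) :
    lowGForm L Δ f ≤ (aD : ℝ) * etaEff L lam2 * Uunit L Δ f := by
  have hLpos : (0 : ℝ) < L := by exact_mod_cast (show 0 < L by omega)
  obtain ⟨hτlo, hτhi⟩ := tau_of_tauCheck L Δ lam2 f c a1 a2 τlo τhi piT hτ hc hL hL0 hL1 hΔ0 hΔ1 hf hν1 hν2 ha1 ha2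
  -- the box and the `ê₁` check
  unfold e1Check at he1
  split at he1
  · exact absurd he1 (by simp)
  · rename_i B hB
    have hmem := rowDBox_mem L Δ lam2 f c a1 a2 pi hB hc hL hL0 hL1 hΔ0 hΔ1 hf hν1 hν2 ha1 ha2
    have e1 := rexprLeOn_sound he1 _ hmem
    simp only [RExpr.eval, cst, vE1, xTrueD_e1] at e1
    push_cast at e1
    have he1' : (τhi : ℝ) - 2 * (eps1 L / (2 * Real.pi / L) ^ 2) ≤ -1 / 1000 := by linarith
    -- the representatives: `T(r_j) ≤ V²t·b_j` (zero-order rows and first-order rows)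
    have hrep : ∀ r ∈ repsZ ++ repsS, lowTerm L Δ f (B1.toTor L r.1.1) (B1.toTor L r.1.2)
        ≤ ((L : ℝ) ^ 2) ^ 2 * (2 * Real.pi / L) ^ 2 * ((r.2 : ℚ) : ℝ) := by
      intro r hr
      have hmemL : r.1 ∈ lowList := of_decide_eq_true (List.all_eq_true.mp hrepsMem r hr)
      have h1 := class_le L Δ lam2 f hL hΔ0 hΔ1 hf τlo τhi hτlo hτhi he1' hmemL
      have h3 : (termE τlo τhi r.1.1 r.1.2).eval (xTrueD L Δ lam2 f) ≤ ((r.2 : ℚ) : ℝ) := by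
        rcases List.mem_append.mp hr with hz | hs
        · have hcls := List.all_eq_true.mp hrepsZ r hz
          unfold classCheck at hcls
          rw [hB] at hcls
          exact rexprLeOn_sound hcls _ hmem
        · exact classCheckS_sound (List.all_eq_true.mp hrepsS r hs) hB hmem
      exact h1.trans (mul_le_mul_of_nonneg_left h3 (by positivity))
    -- the rows: `T(k) = T(w·k) = T(r_j) ≤ V²t·b_j`
    refine lowG_of_rowBounds L Δ lam2 f (by omega) hΔ1 hf c aD τlo (orb.map fun row => (row.1, orbitBudget (repsZ ++ repsS) row))
      (by rw [List.map_map]; exact horb) ?_ (by rw [List.map_map]; exact hsum) haD hτlo0 hτlo hν1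
    intro p hp
    obtain ⟨row, hrow, rfl⟩ := List.mem_map.mp hp
    have hok1 := List.all_eq_true.mp hok row hrow
    unfold orbitRowOk at hok1
    unfold orbitBudget
    split at hok1
    · exact absurd hok1 (by simp)
    · rename_i r hr
      have hw : wordZ row.2.2 row.1 = r.1 := of_decide_eq_true hok1
      have hrmem : r ∈ repsZ ++ repsS := List.mem_of_getElem? hr
      have key := lowTerm_wordZ L (by omega) hf row.2.2 row.1
      rw [hw] at key
      show lowTerm L Δ f (B1.toTor L row.1.1) (B1.toTor L row.1.2) ≤ _
      rw [← key]
      exact hrep r hrmem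

end sound

end T

end RowD

end Summit.HubbardSuperconductivity.HubbardSuperconductivity.Theorems.AnisotropyChord.Transfer.Fibre3
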